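import Literature.AlgebraicGeometry.HodgeTheory.FermatHodgeConjecture
import Literature.AlgebraicGeometry.HodgeTheory.HypersurfaceLefschetz
import Literature.AlgebraicGeometry.Motives.FermatHypersurface
import Mathlib.RingTheory.Polynomial.Eisenstein.Criterion
import Mathlib.RingTheory.Polynomial.Content
import Mathlib.Algebra.MvPolynomial.PDeriv
import Mathlib.Algebra.MvPolynomial.Equiv
import Mathlib.FieldTheory.IsAlgClosed.Basic
import HarnessLib

/-!
# The Hodge conjecture for Fermat varieties: the Fermat form is irreducible, and the reduction to the middle degree

Family `hodge`, layer `Literature/AlgebraicGeometry/HodgeTheory`. Proof file (first layer) for the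
named fact `hodgeClasses_algebraic_fermat` of `FermatHodgeConjecture.lean` (Shioda, Proc. Japan
Acad. 55A (1979) §2 Thm. 1 with the list after it; Ran, Compositio Math. 42 (1980) Thm. 4.9): the
Hodge conjecture, cycle part on the real carriers of the layer, for the Fermat variety
`Xⁿₘ : x₀ᵐ + ⋯ + x_{n+1}ᵐ = 0 ⊂ ℙⁿ⁺¹_ℂ`, `m` prime or `1 < m ≤ 20`.

Shioda, loc. cit. §2 (p. 112), verbatim: "For the Fermat variety `X = Xⁿₘ(0)` over `ℂ`, this is
non-trivial only in case `n` is even and `d = n/2`." This file PROVES that sentence on the tree's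
carriers, i.e. the degree bookkeeping of the printed proof, and isolates the printed theorem proper
(the middle degree) as the single remaining obligation:

1. `irreducible_fermatPolynomial` — **the Fermat form `x₀ᵐ + ⋯ + x_{n+1}ᵐ` in `n + 2 ≥ 3`
   variables is irreducible** over any field in which `m ≠ 0` and `-1` is an `m`-th power (e.g. `ℂ`,
   `irreducible_fermatPolynomial_of_isAlgClosed`). Proof (Eisenstein): in `R[x₀]`,
   `R = k[x₁, …, x_{n+1}]`, the form is `x₀ᵐ + g` with `g = x₁ᵐ + ⋯ + x_{n+1}ᵐ`; the kernel `P` of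
   `φ : R → k[t]`, `x₁ ↦ t`, `x₂ ↦ ηt` (`ηᵐ = -1`), `xᵢ ↦ 0` (`i ≥ 3`) is prime, contains `g`
   (`φ(g) = (1 + ηᵐ)tᵐ = 0`), and `g ∉ P²` because `φ ∘ ∂/∂x₁` kills `P² = P·P` (Leibniz) while
   `φ(∂g/∂x₁) = m tᵐ⁻¹ ≠ 0` (`irreducible_X_pow_add_C_of_derivation`, the abstract Eisenstein
   set-up). Hence (`isSmoothHypersurface_of_isFermatVariety`) a smooth projective Fermat variety of
   dimension `n ≥ 1` and degree `m ≥ 1` is a smooth hypersurface in the sense of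
   `Motives.IsSmoothHypersurface n m X` (file `Motives/Sweep1`, which asks for an irreducible
   defining form) — over a general field this is `Motives.IsFermatVariety.isSmoothHypersurface`
   of `Motives/FermatHypersurface` (irreducibility there by `SmoothHypersurface.irreducible_sum_X_pow`),
   and `isSmoothHypersurface_of_isFermatVariety` is kept as a one-line alias of its `ℂ`-case
   `IsFermatVariety.isSmoothHypersurface_of_charZero` (work item `defn-IsoTransportHeavyAliases`).
2. `mem_algebraicClasses_fermat_of_two_mul_ne` — **off the middle degree every class on `Xⁿₘ` is
   algebraic**, granted the named fact `Voisin2003_smoothHypersurface_algebraicClasses_eq_top`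
   (Lefschetz's theorem on hyperplane sections for smooth hypersurfaces, file
   `HypersurfaceLefschetz`, NOT proved in the tree): degrees `p = 0`, `p ≥ n` and dimension `n = 0`
   unconditionally (`algebraicClasses_eq_top_of_eq_zero_or_le`), `0 < p < n`, `2p ≠ n` by the fact
   applied to the smooth hypersurface of item 1.
3. `hodgeClasses_algebraic_fermat_of_middle` — **the assembly**: `hodgeClasses_algebraic_fermat`
   follows from the Lefschetz fact and ITS MIDDLE-DEGREE CASE `hmid` (Shioda's Thm. 1
   proper: `n = 2p`, `p > 0`, rational `(p, p)`-classes on `X²ᵖₘ` are algebraic), an EXPLICIT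
   HYPOTHESIS of the assembly — a proof obligation of the parent decomposed along the printed proof,
   not a separately tracked named fact (fact-decomposition discipline D-0026; same treatment as the
   analytic hypothesis `h₁` of `lefschetzOneOne_rational_of`, file `LefschetzOneOneProofs`).
   Conversely the fact trivially contains its middle-degree case, so granted Lefschetz the two are
   equivalent (`hodgeClasses_algebraic_fermat_iff_middle`): the middle degree is the exact
   remaining obligation.

## What is NOT here (the middle degree; next layers)

The printed proof of the middle-degree case (Shioda 1979 §4; Ran 1980 §§1, 4) needs, on the real
carriers `Hⁿ(X(ℂ); ℂ)`: the action of `G = μₘⁿ⁺²/Δ` on `Xⁿₘ(ℂ)` and the eigenspace decomposition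
`Hⁿ_prim = ⊕_{α ∈ 𝔄ⁿₘ} V(α)`, `dim V(α) = 1`, with the Hodge type of `V(α)` (Ran Prop. 1.7, after
Griffiths–Ogus; through a Hodge model this also involves the rigidity of natural de Rham comparisons,
named fact `NaturalDeRhamComparisonRigidity`); the inductive structure
`[Hʳ_prim ⊗ Hˢ_prim]^{μₘ} ⊕ [Hʳ⁻¹_prim ⊗ Hˢ⁻¹_prim](1) ≅ Hʳ⁺ˢ_prim` preserving algebraic classes
(Shioda §4 (*); Ran §4, the ruled join `*`, its injectivity Thm. 4.8 and Cor. 4.7); the classes of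
linear subspaces; and the arithmetic condition `(Pⁿₘ)` for `m ≤ 20` (a finite verification) and `m`
prime (Parry; Koblitz–Ogus, via `B_{1,χ} ≠ 0` for odd `χ`). None of these is in the tree.

## References

* [Shioda1979PJA] T. Shioda, The Hodge conjecture and the Tate conjecture for Fermat varieties,
  Proc. Japan Acad. 55A (1979) 111–114, §2 Thm. 1 and the list after it; §4 (text read).
* [Ran1980] Z. Ran, Cycles on Fermat hypersurfaces, Compositio Math. 42 (1980) 121–142, Prop. 1.7,
  Prop. 1.8, Cor. 4.7, Thm. 4.8, Thm. 4.9 (text read, numdam).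
* [VoisinHodgeII2003] C. Voisin, Hodge Theory and Complex Algebraic Geometry II, Cor. 1.24–1.25.
* [Hartshorne1977] R. Hartshorne, Algebraic Geometry, I Ex. 5.9, II.8.20.3 (smooth hypersurfaces).
-/

noncomputable section

open CategoryTheory AlgebraicGeometry

universe u

namespace Literature.AlgebraicGeometry.HodgeTheory

section FermatForm

open Literature.AlgebraicGeometry.Motives

/-! ### An abstract Eisenstein set-up: `xᵐ + g` with `g ∈ P = ker φ`, `g ∉ P²` detected by a derivation -/

/-- **Eisenstein's criterion for `xᵐ + g`, with `g ∉ P²` witnessed by a derivation.** Let `R` be a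
domain, `φ : R → S` a ring map to a domain (so `P = ker φ` is prime) and `D` a derivation of `R`.
If `m ≠ 0`, `φ(g) = 0` and `φ(D g) ≠ 0`, then `xᵐ + g ∈ R[x]` is irreducible: `g ∈ P`, and
`g ∉ P²` because `φ(D(ab)) = φ(a)φ(Db) + φ(b)φ(Da) = 0` for `a, b ∈ P` (Leibniz), so `φ ∘ D`
vanishes on `P² = P·P`; the polynomial is monic, hence primitive, with all lower coefficients
(`0` or `g`) in `P`. [folklore] -/
theorem irreducible_X_pow_add_C_of_derivation {R : Type*} [CommRing R] [IsDomain R]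
    {S : Type*} [CommRing S] [IsDomain S] {K : Type*} [CommSemiring K] [Algebra K R]
    (φ : R →+* S) (D : Derivation K R R) {g : R} {m : ℕ} (hm : m ≠ 0) (hg : φ g = 0)
    (hDg : φ (D g) ≠ 0) : Irreducible (Polynomial.X ^ m + Polynomial.C g : Polynomial R) := by
  set P : Ideal R := RingHom.ker φ
  have hP : P.IsPrime := RingHom.ker_isPrime φ
  have hgP : g ∈ P := (RingHom.mem_ker (f := φ)).2 hg
  -- `φ ∘ D` vanishes on `P * P` (Leibniz)
  have hPP : ∀ h ∈ P * P, φ (D h) = 0 := by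
    intro h hh
    refine Submodule.mul_induction_on hh (fun a ha b hb ↦ ?_) (fun x y hx hy ↦ ?_)
    · have ha' : φ a = 0 := (RingHom.mem_ker (f := φ)).1 ha
      have hb' : φ b = 0 := (RingHom.mem_ker (f := φ)).1 hb
      rw [Derivation.leibniz, smul_eq_mul, smul_eq_mul, map_add, map_mul, map_mul, ha', hb',
        zero_mul, zero_mul, add_zero]
    · rw [map_add, map_add, hx, hy, add_zero]
  have hgP2 : g ∉ P ^ 2 := fun h2 ↦ hDg (hPP g (by rwa [pow_two] at h2))
  have hmon : (Polynomial.X ^ m + Polynomial.C g : Polynomial R).Monic :=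
    Polynomial.monic_X_pow_add_C g hm
  have hdeg : (Polynomial.X ^ m + Polynomial.C g : Polynomial R).degree = m :=
    Polynomial.degree_X_pow_add_C (Nat.pos_of_ne_zero hm) g
  refine Polynomial.irreducible_of_eisenstein_criterion hP ?_ ?_ ?_ ?_ hmon.isPrimitive
  · rw [hmon.leadingCoeff]
    exact fun h1 ↦ hP.ne_top ((Ideal.eq_top_iff_one P).2 h1)
  · intro j hj
    rw [hdeg] at hj
    have hj' : j < m := by exact_mod_cast hj
    rw [Polynomial.coeff_add, Polynomial.coeff_X_pow, if_neg hj'.ne, zero_add, Polynomial.coeff_C]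
    split_ifs
    · exact hgP
    · exact P.zero_mem
  · rw [hdeg]; exact_mod_cast Nat.pos_of_ne_zero hm
  · rwa [Polynomial.coeff_add, Polynomial.coeff_X_pow, if_neg (fun h ↦ hm h.symm), zero_add,
      Polynomial.coeff_C_zero]

/-! ### The Fermat form is irreducible in `≥ 3` variables -/

variable {k : Type u} [Field k]

/-- Splitting off the first variable: under `k[x₀, …, x_{n+1}] ≅ k[x₁, …, x_{n+1}][x₀]`
(`MvPolynomial.finSuccEquiv`) the Fermat form `x₀ᵐ + ⋯ + x_{n+1}ᵐ` becomes
`x₀ᵐ + (x₁ᵐ + ⋯ + x_{n+1}ᵐ)`. [folklore] -/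
theorem finSuccEquiv_fermatPolynomial (n m : ℕ) :
    MvPolynomial.finSuccEquiv k (n + 1) (fermatPolynomial k n m) =
      Polynomial.X ^ m +
        Polynomial.C (∑ i : Fin (n + 1), (MvPolynomial.X i : MvPolynomial (Fin (n + 1)) k) ^ m) := by
  simp only [fermatPolynomial, map_sum, map_pow]
  conv_lhs => rw [Fin.sum_univ_succ, MvPolynomial.finSuccEquiv_X_zero]
  congr 1
  exact Finset.sum_congr rfl fun i _ ↦ by rw [MvPolynomial.finSuccEquiv_X_succ]

/-- The substitution `φ : xᵢ ↦ aᵢt` (a `k`-algebra map `k[x₁, …, x_N] → k[t]`, the prime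
`P = ker φ` of the Eisenstein argument) sends `x₁ᵐ + ⋯ + x_Nᵐ` to `(∑ aᵢᵐ) tᵐ`. [folklore] -/
theorem aeval_C_mul_X_sum_X_pow {N : ℕ} (a : Fin N → k) (m : ℕ) :
    MvPolynomial.aeval (fun i ↦ Polynomial.C (a i) * Polynomial.X)
        (∑ i : Fin N, (MvPolynomial.X i : MvPolynomial (Fin N) k) ^ m) =
      Polynomial.C (∑ i : Fin N, a i ^ m) * Polynomial.X ^ m := by
  simp only [map_sum, map_pow, MvPolynomial.aeval_X, mul_pow, Finset.sum_mul]

/-- With `φ : xᵢ ↦ aᵢt` as above, `φ(∂(x₁ᵐ + ⋯ + x_Nᵐ)/∂x₁) = m a₁ᵐ⁻¹ tᵐ⁻¹` (the first variable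
being indexed by `0`). [folklore] -/
theorem aeval_C_mul_X_pderiv_sum_X_pow {N : ℕ} (a : Fin (N + 1) → k) (m : ℕ) :
    MvPolynomial.aeval (fun i ↦ Polynomial.C (a i) * Polynomial.X)
        (MvPolynomial.pderiv 0
          (∑ i : Fin (N + 1), (MvPolynomial.X i : MvPolynomial (Fin (N + 1)) k) ^ m)) =
      Polynomial.C ((m : k) * a 0 ^ (m - 1)) * Polynomial.X ^ (m - 1) := by
  have hD : MvPolynomial.pderiv 0
      (∑ i : Fin (N + 1), (MvPolynomial.X i : MvPolynomial (Fin (N + 1)) k) ^ m) =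
      (m : MvPolynomial (Fin (N + 1)) k) * MvPolynomial.X 0 ^ (m - 1) := by
    rw [map_sum, Finset.sum_eq_single (0 : Fin (N + 1))]
    · rw [Derivation.leibniz_pow, MvPolynomial.pderiv_X_self, smul_eq_mul, mul_one, nsmul_eq_mul]
    · intro i _ hi
      rw [Derivation.leibniz_pow, MvPolynomial.pderiv_X_of_ne hi, smul_zero, smul_zero]
    · exact fun h ↦ (h (Finset.mem_univ _)).elim
  simp only [hD, map_mul, map_natCast, map_pow, MvPolynomial.aeval_X, mul_pow, mul_assoc]

/-- **The Fermat form is irreducible.** For `n ≥ 1` (at least three variables), `m ≠ 0` in `k`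
and `ηᵐ = -1` for some `η ∈ k`, the form `x₀ᵐ + x₁ᵐ + ⋯ + x_{n+1}ᵐ ∈ k[x₀, …, x_{n+1}]` is
irreducible (Eisenstein in `k[x₁, …, x_{n+1}][x₀]` at the prime `ker (x₁ ↦ t, x₂ ↦ ηt, xᵢ ↦ 0)`;
module docstring). (In two variables `x₀ᵐ + x₁ᵐ` splits into linear factors, and if `m = 0` in
`k` the form is a `p`-th power: both hypotheses are needed.) Hartshorne I Ex. 5.9: a smooth
hypersurface of dimension `≥ 1` is irreducible; here proved algebraically. [folklore] -/
theorem irreducible_fermatPolynomial {n m : ℕ} (hn : 1 ≤ n) (hm : (m : k) ≠ 0) {η : k}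
    (hη : η ^ m = -1) : Irreducible (fermatPolynomial k n m) := by
  have hm0 : m ≠ 0 := by rintro rfl; exact hm Nat.cast_zero
  obtain ⟨n', rfl⟩ : ∃ n', n = n' + 1 := ⟨n - 1, by omega⟩
  -- the substitution `x₁ ↦ t`, `x₂ ↦ η t`, `xᵢ ↦ 0` (`i ≥ 3`)
  obtain ⟨a, ha, ha0⟩ : ∃ a : Fin (n' + 1 + 1) → k, ∑ i, a i ^ m = 0 ∧ a 0 = 1 := by
    refine ⟨Fin.cons 1 (Fin.cons η fun _ ↦ 0), ?_, rfl⟩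
    rw [Fin.sum_univ_succ, Fin.sum_univ_succ]
    simp only [Fin.cons_zero, Fin.cons_succ, one_pow, hη, zero_pow hm0, Finset.sum_const_zero,
      add_zero, add_neg_cancel]
  refine (MulEquiv.irreducible_iff (MvPolynomial.finSuccEquiv k (n' + 1 + 1))).1 ?_
  rw [finSuccEquiv_fermatPolynomial]
  refine irreducible_X_pow_add_C_of_derivation
    (MvPolynomial.aeval fun i ↦ Polynomial.C (a i) * Polynomial.X).toRingHom
    (MvPolynomial.pderiv 0) hm0 ?_ ?_
  · change MvPolynomial.aeval (fun i ↦ Polynomial.C (a i) * Polynomial.X) _ = 0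
    rw [aeval_C_mul_X_sum_X_pow, ha, map_zero, zero_mul]
  · change MvPolynomial.aeval (fun i ↦ Polynomial.C (a i) * Polynomial.X) _ ≠ 0
    rw [aeval_C_mul_X_pderiv_sum_X_pow, ha0, one_pow, mul_one, Polynomial.C_mul_X_pow_eq_monomial,
      Ne, Polynomial.monomial_eq_zero_iff]
    exact hm

/-- Over an algebraically closed field of characteristic `0` (e.g. `ℂ`) the Fermat form in `≥ 3`
variables and of degree `m ≥ 1` is irreducible. [folklore] -/
theorem irreducible_fermatPolynomial_of_isAlgClosed [IsAlgClosed k] [CharZero k] {n m : ℕ}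
    (hn : 1 ≤ n) (hm : 1 ≤ m) : Irreducible (fermatPolynomial k n m) := by
  obtain ⟨η, hη⟩ := IsAlgClosed.exists_pow_nat_eq (-1 : k) hm
  exact irreducible_fermatPolynomial hn (Nat.cast_ne_zero.2 (by omega)) hη

/-- **A smooth projective Fermat variety is a smooth hypersurface** in the sense of
`Motives.IsSmoothHypersurface n m X` (smooth projective, cut out by an irreducible form of degree
`m`): for `n ≥ 1`, `m ≥ 1` the Fermat form is homogeneous of degree `m`
(`Motives.isHomogeneous_fermatPolynomial`) and irreducible (`irreducible_fermatPolynomial`; over a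
general field `SmoothHypersurface.irreducible_sum_X_pow`). ALIAS (same statement) of the `ℂ`-case of
`Motives.IsFermatVariety.isSmoothHypersurface_of_charZero` (`Motives/FermatHypersurface`, which holds
the proof); kept under this name for its users. [folklore] -/
theorem isSmoothHypersurface_of_isFermatVariety {n m : ℕ} {X : SchemeOver ℂ}
    (hX : IsSmoothProjective n X) (hF : IsFermatVariety n m X) (hn : 1 ≤ n) (hm : 1 ≤ m) :
    IsSmoothHypersurface n m X :=
  hF.isSmoothHypersurface_of_charZero hX hn hm

end FermatForm

section HodgeTheory

open Literature.AlgebraicGeometry.Motives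

variable {n m : ℕ} {X : Motives.SchemeOver ℂ}

/-- The degree range of the fact forces `1 ≤ m`. [folklore] -/
theorem one_le_of_prime_or (hm : m.Prime ∨ (1 < m ∧ m ≤ 20)) : 1 ≤ m :=
  hm.elim (fun h ↦ h.one_lt.le) (fun h ↦ h.1.le)

/-! ### Off the middle degree: every class on `Xⁿₘ` is algebraic (granted Lefschetz) -/

/-- **Off the middle degree every class on a Fermat variety is algebraic** ("this is non-trivial
only in case `n` is even and `d = n/2`", Shioda 1979 §2), granted Lefschetz's theorem on hyperplane
sections for smooth hypersurfaces (named fact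
`Voisin2003_smoothHypersurface_algebraicClasses_eq_top`): for `X` smooth projective of dimension `n`,
the Fermat variety of degree `m ≥ 1`, and `2p ≠ n`, `algebraicClasses X p = ⊤`. Dimension `n = 0`
and degrees `p = 0`, `p ≥ n` are unconditional (`algebraicClasses_eq_top_of_eq_zero_or_le`); for
`n ≥ 1`, `0 < p < n` the Fermat variety is a smooth hypersurface
(`isSmoothHypersurface_of_isFermatVariety`) and the fact applies.
[cite: Shioda1979PJA, §2 (p. 112), the sentence preceding Thm. 1]
[cite: VoisinHodgeII2003, Cor. 1.24 and Cor. 1.25] -/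
theorem algebraicClasses_fermat_eq_top_of_two_mul_ne
    (hL : Voisin2003_smoothHypersurface_algebraicClasses_eq_top) (hX : IsSmoothProjective n X)
    (hF : IsFermatVariety n m X) (hm : 1 ≤ m) {p : ℕ} (hp : 2 * p ≠ n) :
    algebraicClasses X p = ⊤ := by
  rcases Nat.eq_zero_or_pos p with rfl | hp0
  · exact algebraicClasses_zero
  rcases le_or_gt n p with hnp | hpn
  · exact algebraicClasses_eq_top_of_eq_zero_or_le hX (Or.inr hnp)
  · exact hL (isSmoothHypersurface_of_isFermatVariety hX hF (by omega) hm) p hp0 hpn hp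

/-- Membership form of `algebraicClasses_fermat_eq_top_of_two_mul_ne`, in the fact's degree range:
granted Lefschetz, for `m` prime or `1 < m ≤ 20` and `2p ≠ n`, every `c ∈ H²ᵖ(Xⁿₘ(ℂ); ℂ)` is an
algebraic class. [cite: Shioda1979PJA, §2 (p. 112), the sentence preceding Thm. 1] -/
theorem mem_algebraicClasses_fermat_of_two_mul_ne
    (hL : Voisin2003_smoothHypersurface_algebraicClasses_eq_top)
    (hm : m.Prime ∨ (1 < m ∧ m ≤ 20)) (hF : IsFermatVariety n m X) (hX : IsSmoothProjective n X)
    {p : ℕ} (hp : 2 * p ≠ n) (c : complexBetti X (2 * p)) : c ∈ algebraicClasses X p := by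
  rw [algebraicClasses_fermat_eq_top_of_two_mul_ne hL hX hF (one_le_of_prime_or hm) hp]
  exact Submodule.mem_top

/-! ### The middle degree, and the assembly -/

/-- **Assembly: the Hodge conjecture for `Xⁿₘ` (`m` prime or `1 < m ≤ 20`) from Lefschetz and the
middle degree.** Granted Lefschetz's theorem on hyperplane sections for smooth hypersurfaces (named
fact `Voisin2003_smoothHypersurface_algebraicClasses_eq_top`) and THE MIDDLE-DEGREE CASE `hmid` —
Shioda's Theorem 1 proper (`n` even, `d = n/2`): for `p > 0`, `m` prime or `1 < m ≤ 20`, and `X`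
smooth projective of dimension `2p` which is the Fermat variety `X²ᵖₘ`, every rational class of Hodge
type `(p, p)` in `H²ᵖ(X(ℂ); ℂ)` lies in `algebraicClasses X p` (an EXPLICIT HYPOTHESIS: a proof
obligation of the named fact decomposed along the printed proof, not a separately tracked named
fact, D-0026; literally the instance family `n = 2p`, `0 < p` of the fact) —
`hodgeClasses_algebraic_fermat` holds: for `2p ≠ n` every class of `H²ᵖ(Xⁿₘ(ℂ); ℂ)` is algebraic
(`mem_algebraicClasses_fermat_of_two_mul_ne`); for `n = 2p`, `p = 0` is `algebraicClasses_zero` and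
`p > 0` is the hypothesis — Shioda 1979 §2: "this is non-trivial only in case `n` is even and
`d = n/2` … Theorem 1".
[cite: Shioda1979PJA, §2 Thm. 1 and the list after it (p. 112)] [cite: Ran1980, Thm. 4.9] -/
theorem hodgeClasses_algebraic_fermat_of_middle
    (hL : Voisin2003_smoothHypersurface_algebraicClasses_eq_top)
    (hmid : ∀ ⦃p m : ℕ⦄ ⦃X : Motives.SchemeOver ℂ⦄, m.Prime ∨ (1 < m ∧ m ≤ 20) →
      Motives.IsFermatVariety (2 * p) m X → Motives.IsSmoothProjective (2 * p) X → 0 < p →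
        ∀ c : complexBetti X (2 * p), IsRationalClass c → IsOfHodgeType (2 * p) X (2 * p) p p c →
          c ∈ algebraicClasses X p) :
    hodgeClasses_algebraic_fermat := by
  intro n m X hm hF hX p c hc hpp
  by_cases hp : 2 * p = n
  · subst hp
    rcases Nat.eq_zero_or_pos p with rfl | hp0
    · rw [algebraicClasses_zero]; exact Submodule.mem_top
    · exact hmid hm hF hX hp0 c hc hpp
  · exact mem_algebraicClasses_fermat_of_two_mul_ne hL hm hF hX hp c

/-- Granted Lefschetz's theorem on hyperplane sections, the named fact is EQUIVALENT to its
middle-degree case `n = 2p`, `p > 0` (the exact remaining obligation; the forward direction is the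
trivial specialisation). [cite: Shioda1979PJA, §2 Thm. 1 and the list after it (p. 112)] -/
theorem hodgeClasses_algebraic_fermat_iff_middle
    (hL : Voisin2003_smoothHypersurface_algebraicClasses_eq_top) :
    hodgeClasses_algebraic_fermat ↔
      ∀ ⦃p m : ℕ⦄ ⦃X : Motives.SchemeOver ℂ⦄, m.Prime ∨ (1 < m ∧ m ≤ 20) →
        Motives.IsFermatVariety (2 * p) m X → Motives.IsSmoothProjective (2 * p) X → 0 < p →
          ∀ c : complexBetti X (2 * p), IsRationalClass c →
            IsOfHodgeType (2 * p) X (2 * p) p p c → c ∈ algebraicClasses X p :=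
  ⟨fun h _ _ _ hm hF hX _ c hc hpp ↦ h hm hF hX _ c hc hpp,
    hodgeClasses_algebraic_fermat_of_middle hL⟩

/-- **Dimension zero and the extreme degrees, unconditionally**: for the (smooth projective) Fermat
variety of any dimension `n` and any degree, a class in `H²ᵖ`, `p = 0` or `p ≥ n`, is algebraic —
no Lefschetz and no Hodge condition needed (`algebraicClasses_eq_top_of_eq_zero_or_le`); in
particular the fact holds outright for `n ≤ 1`. [folklore] -/
theorem hodgeClasses_algebraic_fermat_of_dim_le_one (hn : n ≤ 1)
    (hX : IsSmoothProjective n X) (p : ℕ) (c : complexBetti X (2 * p)) :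
    c ∈ algebraicClasses X p := by
  rw [algebraicClasses_eq_top_of_eq_zero_or_le hX (p := p) (by omega)]
  exact Submodule.mem_top

end HodgeTheory

end Literature.AlgebraicGeometry.HodgeTheory

end
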